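import Summits.CriticalPhenomena.PercolationContinuityZ3.Theorems.PercNearOneGluingNoHeavyLowerTailMajorityGluingQCertSym3
import HarnessLib

/-!
# Soundness of the symmetrised degree-3 certificates over a finite family of points (lane prim-rate, constants-miner 1, gen 36; NEXT-g37 item 1)

Support file for the closed crux `NoHeavyLowerTail` (stmt-CriticalPhenomena-4575), majority-gluing line; companion of `…MajorityGluingQCertSym3` (the cubic analogue of
`…QCertSymSound`).  For a finite nonempty family `(v_g)` of nonnegative points with common `v_g(D) = δ` and common threshold value `T(v_g) = μ_T`, satisfying the marginal
hypotheses and the listed rows, and a key valuation with the CUBIC ORBIT PROPERTY `val (keyS3 m i j k) = Msym3 v i j k = Σ_g v_g(i) v_g(j) v_g(k)` at which the contribution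
list evaluates nonnegatively, a structurally sound certificate gives **`cD·μ_T ≤ cN·δ`** (`SymCert3.sound3S_of_nonneg`, `sound3S`).  No percolation, no sorries.
-/

namespace Summit.CriticalPhenomena.PercolationContinuityZ3.Theorems

namespace HubOnly
namespace QCert

noncomputable section

open scoped BigOperators

variable {G : Type*} [Fintype G]

/-! ### Sums against the symmetrised third moments -/

/-- **Column sums** (first index varies): `Σ_{i∈S} w_i·Msym3(i,a,b) = Σ_g (Σ_{i∈S} w_i v_g(i))·(v_g(a) v_g(b))`. -/
theorem col_Msym3 (v : G → ℕ → ℝ) (a b : ℕ) (w : ℕ → ℝ) :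
    ∀ S : List ℕ, (S.map fun i => w i * Msym3 v i a b).sum = ∑ g, (S.map fun i => w i * v g i).sum * (v g a * v g b)
  | [] => by simp
  | x :: S => by
    simp only [List.map_cons, List.sum_cons]
    rw [col_Msym3 v a b w S, Msym3, Finset.mul_sum, ← Finset.sum_add_distrib]
    refine Finset.sum_congr rfl fun g _ => ?_
    ring

/-- **Middle sums** (second index varies): `Σ_{j∈S} w_j·Msym3(a,j,t) = Σ_g v_g(a)·(Σ_{j∈S} w_j v_g(j))·v_g(t)`. -/
theorem mid_Msym3 (v : G → ℕ → ℝ) (a t : ℕ) (w : ℕ → ℝ) :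
    ∀ S : List ℕ, (S.map fun j => w j * Msym3 v a j t).sum = ∑ g, v g a * (S.map fun j => w j * v g j).sum * v g t
  | [] => by simp
  | x :: S => by
    simp only [List.map_cons, List.sum_cons]
    rw [mid_Msym3 v a t w S, Msym3, Finset.mul_sum, ← Finset.sum_add_distrib]
    refine Finset.sum_congr rfl fun g _ => ?_
    ring

/-- **Grid sums with a fixed third index:** `Σ_{i∈S₁} Σ_{j∈S₂} w₁(i) w₂(j) Msym3(i,j,t) = Σ_g (Σ w₁ v_g)(Σ w₂ v_g)·v_g(t)`. -/
theorem grid_Msym3 (v : G → ℕ → ℝ) (w₁ w₂ : ℕ → ℝ) (S₂ : List ℕ) (t : ℕ) :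
    ∀ S₁ : List ℕ, (S₁.map fun i => (S₂.map fun j => w₁ i * w₂ j * Msym3 v i j t).sum).sum =
        ∑ g, (S₁.map fun i => w₁ i * v g i).sum * (S₂.map fun j => w₂ j * v g j).sum * v g t
  | [] => by simp
  | a :: S₁ => by
    simp only [List.map_cons, List.sum_cons]
    have hin : (S₂.map fun j => w₁ a * w₂ j * Msym3 v a j t).sum = w₁ a * ∑ g, v g a * (S₂.map fun j => w₂ j * v g j).sum * v g t := by
      rw [← mid_Msym3 v a t w₂ S₂, ← List.sum_map_mul_left]
      congr 1; refine List.map_congr_left fun j _ => ?_; ring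
    rw [hin, grid_Msym3 v w₁ w₂ S₂ t S₁, Finset.mul_sum, ← Finset.sum_add_distrib]
    refine Finset.sum_congr rfl fun g _ => ?_
    ring

namespace SymCert3

variable (c : SymCert3)

section Eval

variable (v : G → ℕ → ℝ) (val : ℕ → ℝ) (hkey : ∀ i < c.NV, ∀ j < c.NV, ∀ k < c.NV, val (c.key i j k) = Msym3 v i j k)
include hkey

/-- **Product contributions:** `evalC (prodC3S m1 m2 t z) = z·Σ_g f₁(v_g)·f₂(v_g)·v_g(t)`. -/
theorem evalC_prodC3S (m1 m2 t : ℕ) (ht : t < c.NV) (z : ℤ) :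
    evalC val (c.prodC3S m1 m2 t z) =
      (z : ℝ) * ∑ g, linv c.NV (fun i => Cert.bi (tb m1 i)) (v g) * linv c.NV (fun i => Cert.bi (tb m2 i)) (v g) * v g t := by
  unfold prodC3S
  rw [evalC_flatten, List.map_map]
  have hc : (suppOf c.NV (tb m1)).map (evalC val ∘ fun i => (suppOf c.NV (tb m2)).map fun j => (c.key i j t, z)) =
      (suppOf c.NV (tb m1)).map fun i => ((suppOf c.NV (tb m2)).map fun j => (1 : ℝ) * (z : ℝ) * Msym3 v i j t).sum :=
    List.map_congr_left fun i hi => by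
      rw [Function.comp_apply, evalC_map]
      congr 1
      refine List.map_congr_left fun j hj => ?_
      simp only []
      rw [hkey i (mem_suppOf hi).1 j (mem_suppOf hj).1 t ht]; ring
  rw [hc, grid_Msym3 v (fun _ => 1) (fun _ => (z : ℝ)), Finset.mul_sum]
  refine Finset.sum_congr rfl fun g _ => ?_
  rw [map_one_mul, List.sum_map_mul_left, linv_bi_eq_suppOf, linv_bi_eq_suppOf]
  ring

/-- **Row contributions:** `evalC (rowC3S r) = −n·Σ_g (f₃f₄ − f₁f₂)(v_g)·v_g(t)`. -/
theorem evalC_rowC3S (r : RowE3) (ht : r.t < c.NV) :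
    evalC val (c.rowC3S r) =
      -((r.row.n : ℝ) * ∑ g, (linv c.NV (fun i => Cert.bi (tb r.row.m3 i)) (v g) * linv c.NV (fun i => Cert.bi (tb r.row.m4 i)) (v g) -
        linv c.NV (fun i => Cert.bi (tb r.row.m1 i)) (v g) * linv c.NV (fun i => Cert.bi (tb r.row.m2 i)) (v g)) * v g r.t) := by
  unfold rowC3S
  rw [evalC_append, c.evalC_prodC3S v val hkey _ _ _ ht, c.evalC_prodC3S v val hkey _ _ _ ht, Finset.mul_sum, Finset.mul_sum, Finset.mul_sum,
    ← Finset.sum_neg_distrib, ← Finset.sum_add_distrib]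
  refine Finset.sum_congr rfl fun g _ => ?_
  push_cast; ring

/-- **Square contributions:** `evalC (sqC3S s) = −n·Σ_g u(v_g)²·v_g(t)`. -/
theorem evalC_sqC3S (s : SqE3) (ht : s.t < c.NV) :
    evalC val (c.sqC3S s) = -((s.sq.n : ℝ) * ∑ g, linv c.NV s.sq.u (v g) * linv c.NV s.sq.u (v g) * v g s.t) := by
  unfold sqC3S
  rw [evalC_flatten, List.map_map]
  set U := suppOf c.NV (tb (s.sq.m1 ||| s.sq.m2)) with hU
  have hc : U.map (evalC val ∘ fun i => U.map fun j => (c.key i j s.t, -((s.sq.n : ℤ) * s.sq.u i * s.sq.u j))) =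
      U.map fun i => (U.map fun j => (s.sq.u i : ℝ) * (-(s.sq.n : ℝ) * (s.sq.u j : ℝ)) * Msym3 v i j s.t).sum :=
    List.map_congr_left fun i hi => by
      rw [Function.comp_apply, evalC_map]
      congr 1
      refine List.map_congr_left fun j hj => ?_
      simp only []
      rw [hkey i (mem_suppOf hi).1 j (mem_suppOf hj).1 _ ht]; push_cast; ring
  rw [hc, grid_Msym3 v (fun i => (s.sq.u i : ℝ)) (fun j => -(s.sq.n : ℝ) * (s.sq.u j : ℝ)), Finset.mul_sum, ← Finset.sum_neg_distrib]
  refine Finset.sum_congr rfl fun g _ => ?_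
  rw [linv_u_eq_suppOf]
  have h2 : (U.map fun j => -(s.sq.n : ℝ) * (s.sq.u j : ℝ) * v g j) = U.map fun j => -(s.sq.n : ℝ) * ((s.sq.u j : ℝ) * v g j) :=
    List.map_congr_left fun j _ => by ring
  rw [h2, List.sum_map_mul_left]
  ring

/-- **Multiplier contributions:** `evalC (ell2C (a, b, n)) = n·Σ_g Λ(v_g)·v_g(a)·v_g(b)`. -/
theorem evalC_ell2C (e : ℕ × ℕ × ℕ) (ha : e.1 < c.NV) (hb : e.2.1 < c.NV) :
    evalC val (c.ell2C e) = (e.2.2 : ℝ) * ∑ g, c.base.Λ (v g) * (v g e.1 * v g e.2.1) := by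
  unfold ell2C Cert.Λ
  rw [evalC, List.map_cons, List.sum_cons, ← evalC, evalC_map, hkey _ c.base.D_lt_NV _ ha _ hb, Msym3]
  have hc : ((suppOf c.NV c.base.tMem).map fun i => (((c.key i e.1 e.2.1, -((e.2.2 : ℤ) * c.base.cD)) : ℕ × ℤ).2 : ℝ) *
      val ((c.key i e.1 e.2.1, -((e.2.2 : ℤ) * c.base.cD)) : ℕ × ℤ).1) =
      (suppOf c.NV c.base.tMem).map fun i => (-((e.2.2 : ℝ) * c.base.cD)) * Msym3 v i e.1 e.2.1 :=
    List.map_congr_left fun i hi => by simp only []; rw [hkey i (mem_suppOf hi).1 _ ha _ hb]; push_cast; ring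
  rw [hc, col_Msym3 v e.1 e.2.1, Finset.mul_sum, Finset.mul_sum, ← Finset.sum_add_distrib]
  refine Finset.sum_congr rfl fun g _ => ?_
  rw [List.sum_map_mul_left, linv_bi_eq_suppOf]
  push_cast; ring

/-- **Marginal-slack contributions:** `evalC (linC3 (x, a, b, n)) = −n·Σ_g (v_g(D) − m_x(v_g))·v_g(a) v_g(b)`. -/
theorem evalC_linC3 (e : ℕ × ℕ × ℕ × ℕ) (ha : e.2.1 < c.NV) (hb : e.2.2.1 < c.NV) :
    evalC val (c.linC3 e) =
      -((e.2.2.2 : ℝ) * ∑ g, (v g c.base.D - linv c.NV (fun i => Cert.bi (c.base.margMem e.1 i)) (v g)) * (v g e.2.1 * v g e.2.2.1)) := by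
  unfold linC3
  rw [evalC, List.map_cons, List.sum_cons, ← evalC, evalC_map, hkey _ c.base.D_lt_NV _ ha _ hb, Msym3]
  have hc : ((suppOf c.NV (c.base.margMem e.1)).map fun i => (((c.key i e.2.1 e.2.2.1, (e.2.2.2 : ℤ)) : ℕ × ℤ).2 : ℝ) *
      val ((c.key i e.2.1 e.2.2.1, (e.2.2.2 : ℤ)) : ℕ × ℤ).1) =
      (suppOf c.NV (c.base.margMem e.1)).map fun i => (e.2.2.2 : ℝ) * Msym3 v i e.2.1 e.2.2.1 :=
    List.map_congr_left fun i hi => by simp only []; rw [hkey i (mem_suppOf hi).1 _ ha _ hb]; push_cast; ring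
  rw [hc, col_Msym3 v e.2.1 e.2.2.1, Finset.mul_sum, Finset.mul_sum, ← Finset.sum_neg_distrib, ← Finset.sum_add_distrib]
  refine Finset.sum_congr rfl fun g _ => ?_
  rw [List.sum_map_mul_left, linv_bi_eq_suppOf]
  push_cast; ring

end Eval

/-! ### Soundness -/

/-- Facts extracted from `checkW3S`. -/
theorem checkW3S_spec (h : c.checkW3S = true) :
    0 < c.base.cD ∧ 1 ≤ c.base.h ∧ 0 < c.ell2DDS ∧ (∀ e ∈ c.ell2, e.1 < c.NV ∧ e.2.1 < c.NV) ∧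
    (∀ e ∈ c.lin, e.1 < c.base.m ∧ e.2.1 < c.NV ∧ e.2.2.1 < c.NV) ∧
    (∀ ch ∈ c.rows, ∀ r ∈ ch, c.base.rowOK r.row = true ∧ r.t < c.NV) ∧ (∀ ch ∈ c.sqs, ∀ s ∈ ch, s.t < c.NV) := by
  unfold checkW3S at h
  simp only [Bool.and_eq_true] at h
  obtain ⟨⟨⟨⟨⟨⟨h1, h2⟩, h3⟩, h4⟩, h5⟩, h6⟩, h7⟩ := h
  rw [List.all_eq_true] at h4 h5 h6 h7
  refine ⟨of_decide_eq_true h1, of_decide_eq_true h2, of_decide_eq_true h3, fun e he => ?_, fun e he => ?_, fun ch hch r hr => ?_,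
    fun ch hch s hs => ?_⟩
  · have h := h4 e he
    simp only [Bool.and_eq_true, decide_eq_true_eq] at h
    exact h
  · have h := h5 e he
    simp only [Bool.and_eq_true, decide_eq_true_eq] at h
    exact ⟨h.1.1, h.1.2, h.2⟩
  · have h := h6 ch hch
    rw [List.all_eq_true] at h
    have h' := h r hr
    simp only [Bool.and_eq_true, decide_eq_true_eq] at h'
    exact h'
  · have h := h7 ch hch
    rw [List.all_eq_true] at h
    exact of_decide_eq_true (h s hs)

/-- `ℓ₂[δ²]·Σ_g v_g(D)² ≤ Σ_{(a,b,n)} n·Σ_g v_g(a)v_g(b)` at nonnegative points. -/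
theorem ell2DDS_mul_le (v : G → ℕ → ℝ) (hv : ∀ g i, 0 ≤ v g i) :
    (c.ell2DDS : ℝ) * ∑ g, v g c.base.D * v g c.base.D ≤ (c.ell2.map fun e => (e.2.2 : ℝ) * ∑ g, v g e.1 * v g e.2.1).sum := by
  unfold ell2DDS
  rw [natCast_listSum, ← listSum_mul_const]
  refine listSum_mono _ _ _ fun e _ => ?_
  split_ifs with h
  · rw [h.1, h.2]
  · rw [Nat.cast_zero, zero_mul]; exact mul_nonneg (Nat.cast_nonneg _) (Finset.sum_nonneg fun g _ => mul_nonneg (hv g _) (hv g _))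

/-- **SOUNDNESS, evaluation form (degree 3).** -/
theorem sound3S_of_nonneg [Nonempty G] (hW : c.checkW3S = true) (v : G → ℕ → ℝ) (hv : ∀ g i, 0 ≤ v g i)
    (val : ℕ → ℝ) (hpos : 0 ≤ evalC val c.contribs3S) (hkey : ∀ i < c.NV, ∀ j < c.NV, ∀ k < c.NV, val (c.key i j k) = Msym3 v i j k)
    (δ μT : ℝ) (hD : ∀ g, v g c.base.D = δ) (hT : ∀ g, linv c.NV (fun i => Cert.bi (c.base.tMem i)) (v g) = μT)
    (hmarg : ∀ g, ∀ x < c.base.m, linv c.NV (fun i => Cert.bi (c.base.margMem x i)) (v g) ≤ v g c.base.D)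
    (hrows : ∀ g, ∀ ch ∈ c.rows, ∀ r ∈ ch,
      linv c.NV (fun i => Cert.bi (tb r.row.m1 i)) (v g) * linv c.NV (fun i => Cert.bi (tb r.row.m2 i)) (v g) ≤
        linv c.NV (fun i => Cert.bi (tb r.row.m3 i)) (v g) * linv c.NV (fun i => Cert.bi (tb r.row.m4 i)) (v g)) :
    (c.base.cD : ℝ) * μT ≤ c.base.cN * δ := by
  obtain ⟨_, hh, hDD, hell, hlin, hrow, hsq⟩ := c.checkW3S_spec hW
  have hsplit : evalC val c.contribs3S =
      ((c.ell2.map c.ell2C).map (evalC val)).sum + ((c.lin.map c.linC3).map (evalC val)).sum +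
      ((c.rows.map fun ch => (ch.map c.rowC3S).flatten).map (evalC val)).sum +
      ((c.sqs.map fun ch => (ch.map c.sqC3S).flatten).map (evalC val)).sum := by
    unfold contribs3S; rw [evalC_append, evalC_append, evalC_append, evalC_flatten, evalC_flatten, evalC_flatten, evalC_flatten]
  have hΛ : ∀ g, c.base.Λ (v g) = c.base.cN * δ - c.base.cD * μT := fun g => by unfold Cert.Λ; rw [hD g, hT g]
  have h1 : ((c.ell2.map c.ell2C).map (evalC val)).sum =
      (c.base.cN * δ - c.base.cD * μT) * (c.ell2.map fun e => (e.2.2 : ℝ) * ∑ g, v g e.1 * v g e.2.1).sum := by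
    rw [List.map_map, ← List.sum_map_mul_left]
    congr 1
    refine List.map_congr_left fun e he => ?_
    rw [Function.comp_apply, c.evalC_ell2C v val hkey e (hell e he).1 (hell e he).2, Finset.mul_sum, Finset.mul_sum, Finset.mul_sum]
    refine Finset.sum_congr rfl fun g _ => ?_
    rw [hΛ g]; ring
  have h2 : ((c.lin.map c.linC3).map (evalC val)).sum ≤ 0 := by
    rw [List.map_map]
    refine listSum_nonpos _ _ fun e he => ?_
    obtain ⟨hx, ha, hb⟩ := hlin e he
    rw [Function.comp_apply, c.evalC_linC3 v val hkey e ha hb, neg_nonpos]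
    exact mul_nonneg (Nat.cast_nonneg _) (Finset.sum_nonneg fun g _ =>
      mul_nonneg (sub_nonneg.2 (hmarg g e.1 hx)) (mul_nonneg (hv g _) (hv g _)))
  have h3 : ((c.rows.map fun ch => (ch.map c.rowC3S).flatten).map (evalC val)).sum ≤ 0 := by
    rw [List.map_map]
    refine listSum_nonpos _ _ fun ch hch => ?_
    rw [Function.comp_apply, evalC_flatten, List.map_map]
    refine listSum_nonpos _ _ fun r hr => ?_
    rw [Function.comp_apply, c.evalC_rowC3S v val hkey r (hrow ch hch r hr).2, neg_nonpos]
    exact mul_nonneg (Nat.cast_nonneg _) (Finset.sum_nonneg fun g _ => mul_nonneg (sub_nonneg.2 (hrows g ch hch r hr)) (hv g _))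
  have h4 : ((c.sqs.map fun ch => (ch.map c.sqC3S).flatten).map (evalC val)).sum ≤ 0 := by
    rw [List.map_map]
    refine listSum_nonpos _ _ fun ch hch => ?_
    rw [Function.comp_apply, evalC_flatten, List.map_map]
    refine listSum_nonpos _ _ fun s hs => ?_
    rw [Function.comp_apply, c.evalC_sqC3S v val hkey s (hsq ch hch s hs), neg_nonpos]
    exact mul_nonneg (Nat.cast_nonneg _) (Finset.sum_nonneg fun g _ => mul_nonneg (mul_self_nonneg _) (hv g _))
  have hmain : 0 ≤ (c.base.cN * δ - c.base.cD * μT) * (c.ell2.map fun e => (e.2.2 : ℝ) * ∑ g, v g e.1 * v g e.2.1).sum := by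
    rw [hsplit, h1] at hpos; linarith
  have hellle := c.ell2DDS_mul_le v hv
  have hsumD : ∑ g : G, v g c.base.D * v g c.base.D = Fintype.card G * (δ * δ) := by
    rw [Finset.sum_congr rfl fun g _ => by rw [hD g], Finset.sum_const, Finset.card_univ, nsmul_eq_mul]
  obtain ⟨g₀⟩ := (inferInstance : Nonempty G)
  have hδ0 : 0 ≤ δ := by rw [← hD g₀]; exact hv g₀ _
  rcases eq_or_lt_of_le hδ0 with hδ | hδ
  · have h0 := c.base.tForm_eq_zero hh (v g₀) (hv g₀) (hmarg g₀) (by rw [hD g₀, ← hδ])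
    rw [hT g₀] at h0
    rw [h0, ← hδ, mul_zero, mul_zero]
  · have hcard : (0 : ℝ) < Fintype.card G := by exact_mod_cast Fintype.card_pos
    have hellpos : 0 < (c.ell2.map fun e => (e.2.2 : ℝ) * ∑ g, v g e.1 * v g e.2.1).sum :=
      lt_of_lt_of_le (by rw [hsumD]; exact mul_pos (by exact_mod_cast hDD) (mul_pos hcard (mul_pos hδ hδ))) hellle
    have hΛ0 : 0 ≤ c.base.cN * δ - c.base.cD * μT := by
      by_contra hneg
      push Not at hneg
      have := mul_neg_of_neg_of_pos hneg hellpos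
      linarith
    linarith

/-- **SOUNDNESS OF THE SYMMETRISED DEGREE-3 CERTIFICATES (abstract).** -/
theorem sound3S [Nonempty G] (fuel : ℕ) (hW : c.checkW3S = true) (hQ : c.checkQ3S fuel = true) (v : G → ℕ → ℝ) (hv : ∀ g i, 0 ≤ v g i)
    (val : ℕ → ℝ) (hval : ∀ k, 0 ≤ val k) (hkey : ∀ i < c.NV, ∀ j < c.NV, ∀ k < c.NV, val (c.key i j k) = Msym3 v i j k)
    (δ μT : ℝ) (hD : ∀ g, v g c.base.D = δ) (hT : ∀ g, linv c.NV (fun i => Cert.bi (c.base.tMem i)) (v g) = μT)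
    (hmarg : ∀ g, ∀ x < c.base.m, linv c.NV (fun i => Cert.bi (c.base.margMem x i)) (v g) ≤ v g c.base.D)
    (hrows : ∀ g, ∀ ch ∈ c.rows, ∀ r ∈ ch,
      linv c.NV (fun i => Cert.bi (tb r.row.m1 i)) (v g) * linv c.NV (fun i => Cert.bi (tb r.row.m2 i)) (v g) ≤
        linv c.NV (fun i => Cert.bi (tb r.row.m3 i)) (v g) * linv c.NV (fun i => Cert.bi (tb r.row.m4 i)) (v g)) :
    (c.base.cD : ℝ) * μT ≤ c.base.cN * δ :=
  c.sound3S_of_nonneg hW v hv val (evalC_nonneg_of_runsOK_msort2 _ hval fuel _ hQ) hkey δ μT hD hT hmarg hrows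

end SymCert3

end

end QCert
end HubOnly

end Summit.CriticalPhenomena.PercolationContinuityZ3.Theorems
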